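import Summits.ResolutionOfSingularities.ResolutionOfSingularities.Theorems.CouplingMapKernels
import Summits.ResolutionOfSingularities.ResolutionOfSingularities.Theorems.DescentMapRoot
import Summits.ResolutionOfSingularities.ResolutionOfSingularities.Theorems.RestrictCutPort2
import HarnessLib

/-! # CouplingMapRoot — decomp-res-lens-4 g40 second node «CouplingMap», FILE D (§138b: the route item 27727 `MaxContactCut.CCCouplingPortAll`
DECIDED and the g40 root consumers with the coupling port (FILE C) and the factor-contact port (g34 `factorContactPort(All)_holds`,
Theorems/RestrictCutPort2 — bookkeeping) DISCHARGED: `ftt_step_of_g40b`, `forcedTowersTerminate_of_g40b`, `noForcedTowers_of_g40b`,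
`noForcedTowers_of_g40b_residual`).  VERBATIM slice of HOME/decomp-res-lens-4/g40/CouplingMap.lean. -/

set_option linter.dupNamespace false
set_option linter.unusedSectionVars false

noncomputable section

open CategoryTheory AlgebraicGeometry IsLocalRing TopologicalSpace
open Literature.AlgebraicGeometry.Resolution
open Summit.ResolutionOfSingularities.ResolutionOfSingularities.Theses
open Summit.ResolutionOfSingularities.ResolutionOfSingularities.Theorems
open WeakOrderReduction ForcedTowerClasses DivergentTowerClasses MonomialTowerClasses
open HugDimensionClasses HugDimensionKernels SurfaceShadowClasses SurfaceShadowKernels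
open NearPointCut (SingularClass)
open Scheme.IdealSheafData (vanishingIdeal)
open Literature.AlgebraicGeometry.Resolution.Hironaka2005 (le_idealOrder_of_mul_le le_idealOrder_of_mul_le')

universe u

namespace Summit.ResolutionOfSingularities.ResolutionOfSingularities.Theorems.HugValuationCut

/-! ## ══ FILE D `Theorems/CouplingMapRoot.lean` (§138b; imports FILE C + the LANDED `DescentMapRoot` + `RestrictCutPort2`) ══ -/

section CouplingRoot

/-! ## §138b (g40 · NEW · RE-ROOTING) THE ROUTE ITEM 27727 DECIDED AND THE ROOT CONSUMERS WITH THE COUPLING PORT (this node) AND THE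
FACTOR-CONTACT PORT (g34, bookkeeping) DISCHARGED

EXACTLY the g40 root theorems (`ftt_step_of_g40`, `forcedTowersTerminate_of_g40`, `noForcedTowers_of_g40`, `noForcedTowers_of_g40_residual`)
with the binders `hCo : CouplingPort n` / `CouplingPortAll` replaced by `couplingPort_holds` / `couplingPortAll_holds` (THIS NODE) and
`hFC : FactorContactPort n` / `FactorContactPortAll` replaced by g34's `factorContactPort_holds n hn` / `factorContactPortAll_holds`
(Theorems/RestrictCutPort2 — a tree theorem since g34, merely outside the root's import cone until now: BOOKKEEPING, counted 0); every
other hypothesis unchanged and in the same order. -/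

/-- **ROUTE ITEM 27727 `MaxContactCut.CCCouplingPortAll` (the g18 COSTUME port «∀ n ≥ 1, CouplingPort n», aside of route
MaxContactCut) DECIDED: it holds.** (Sources: Kollar2007, 3.58–3.60; BierstoneGrigorievMilmanWlodarczyk2011, §3.1–3.2.) -/
theorem ccCouplingPortAll_holds : MaxContactCut.CCCouplingPortAll := couplingPortAll_holds

/-- **the root piece at weight `n`, port-free in `hDesc`, `hFC`, `hCo`.** [folklore] -/
theorem ftt_step_of_g40b {n : ℕ} (hn : 1 ≤ n) (hMo : MonomialCorner n) (hC : CurveLaw n) (hSL : SurfaceLaw n)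
    (hH : HypersurfaceHuggingTowersTerminate n) (hP : ShadowPort n) (hM : MarkingPort n)
    (hRi : RiderPort n) (h71 : ContactHuggingTowersTerminate n) (h640 : SurfaceChainPort)
    (hB : WildLatentFactorNonThreefoldMixedWallFreeFreshJumpShallowCompanionKangarooTowersTerminate n)
    (hK : WildOccultDivisorialThreefoldNonLineRecurrentCompanionCurveFreeBirthRecurrentCofactorBirthRecurrentMixedWallFreeFreshJumpShallowCompanionKangarooTowersTerminate
      n)
    (hC4 : WildOccultDivisorialNonThreefoldMixedWallFreeFreshJumpShallowCompanionKangarooTowersTerminate n)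
    (hD4 : WildOccultNonDivisorialNonThreefoldMixedWallFreeFreshJumpShallowCompanionKangarooTowersTerminate n)
    (hNP : ContactFreeNonPrincipalInLocusTowersTerminate n) (hPu : PurePrincipalTowersTerminate n)
    (hR : IncommensurableWildDriftingImperfectTowersTerminate n)
    (hlow : ∀ n' : ℕ, 1 ≤ n' → n' < n → ForcedTowersTerminate n') : ForcedTowersTerminate n :=
  ftt_step_of_g40 hn hMo hC hSL hH hP hM (factorContactPort_holds n hn) (couplingPort_holds n) hRi h71 h640 hB hK hC4 hD4
    hNP hPu hR hlow

/-- **`∀ n ≥ 1, ForcedTowersTerminate n` by strong induction on the weight, port-free in `hDesc`, `hFC`, `hCo`.** [folklore] -/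
theorem forcedTowersTerminate_of_g40b (hMo : MaxContactCut.MonomialCornerAll) (hC : MaxContactCut.CurveLawAll)
    (hSL : MaxContactCut.SurfaceLawAll) (hH : MaxContactCut.NoHypersurfaceHuggingTowers) (hP : ShadowPortAll)
    (hM : MarkingPortAll) (hRi : RiderPortAll) (h71 : MaxContactCut.NoContactHuggingTowers) (h640 : SurfaceChainPort)
    (hB : NoWildLatentFactorNonThreefoldMixedTowers)
    (hcore : ∀ n : ℕ, 1 ≤ n → MinimalAt n →
      WildOccultDivisorialThreefoldNonLineRecurrentCompanionCurveFreeBirthRecurrentCofactorBirthRecurrentMixedWallFreeFreshJumpShallowCompanionKangarooTowersTerminate n)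
    (hC4 : NoWildOccultDivisorialNonThreefoldMixedTowers) (hD4 : NoWildOccultNonDivisorialNonThreefoldMixedTowers)
    (hNP : NoContactFreeNonPrincipalInLocusTowers) (hPu : NoPurePrincipalTowers) (hR : NoIncommensurableWildDriftingImperfectTowers) :
    ∀ n : ℕ, 1 ≤ n → ForcedTowersTerminate n :=
  forcedTowersTerminate_of_g40 hMo hC hSL hH hP hM factorContactPortAll_holds couplingPortAll_holds hRi h71 h640 hB hcore hC4 hD4
    hNP hPu hR

/-- **30253 `MaxContactCut.NoForcedTowers` BY NAME from the g39 cells, the ports of `noForcedTowers_of_g22` MINUS THE DESCENT, FACTOR-CONTACT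
AND COUPLING PORTS, 31571, CELL B, C₄, D₄.** [folklore] -/
theorem noForcedTowers_of_g40b (hMo : MaxContactCut.MonomialCornerAll) (hC : MaxContactCut.CurveLawAll)
    (hSL : MaxContactCut.SurfaceLawAll) (hH : MaxContactCut.NoHypersurfaceHuggingTowers) (hP : ShadowPortAll)
    (hM : MarkingPortAll) (hRi : RiderPortAll) (h71 : MaxContactCut.NoContactHuggingTowers) (h640 : SurfaceChainPort)
    (hB : NoWildLatentFactorNonThreefoldMixedTowers)
    (hcore : ∀ n : ℕ, 1 ≤ n → MinimalAt n →
      WildOccultDivisorialThreefoldNonLineRecurrentCompanionCurveFreeBirthRecurrentCofactorBirthRecurrentMixedWallFreeFreshJumpShallowCompanionKangarooTowersTerminate n)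
    (hC4 : NoWildOccultDivisorialNonThreefoldMixedTowers) (hD4 : NoWildOccultNonDivisorialNonThreefoldMixedTowers)
    (hNP : NoContactFreeNonPrincipalInLocusTowers) (hPu : NoPurePrincipalTowers) (hR : NoIncommensurableWildDriftingImperfectTowers) :
    MaxContactCut.NoForcedTowers :=
  noForcedTowers_of_g40 hMo hC hSL hH hP hM factorContactPortAll_holds couplingPortAll_holds hRi h71 h640 hB hcore hC4 hD4 hNP hPu hR

/-- the same from the ABSOLUTE g39 located residual by name. [folklore] -/
theorem noForcedTowers_of_g40b_residual (hMo : MaxContactCut.MonomialCornerAll) (hC : MaxContactCut.CurveLawAll)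
    (hSL : MaxContactCut.SurfaceLawAll) (hH : MaxContactCut.NoHypersurfaceHuggingTowers) (hP : ShadowPortAll)
    (hM : MarkingPortAll) (hRi : RiderPortAll) (h71 : MaxContactCut.NoContactHuggingTowers) (h640 : SurfaceChainPort)
    (hB : NoWildLatentFactorNonThreefoldMixedTowers) (hres : NoWildOccultCofactorBirthRecurrentCurveFreeCompanionNonLineMixedTowers)
    (hNP : NoContactFreeNonPrincipalInLocusTowers) (hPu : NoPurePrincipalTowers) (hR : NoIncommensurableWildDriftingImperfectTowers) :
    MaxContactCut.NoForcedTowers :=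
  noForcedTowers_of_g40_residual hMo hC hSL hH hP hM factorContactPortAll_holds couplingPortAll_holds hRi h71 h640 hB hres hNP hPu hR

end CouplingRoot

end Summit.ResolutionOfSingularities.ResolutionOfSingularities.Theorems.HugValuationCut
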